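import Mathlib

/-!
# PercRepro — LOG-CONCAVE SEQUENCES ARE CLOSED UNDER CONVOLUTION
(p10, gen 38)

A nonnegative sequence indexed by `ℤ`, vanishing on the negative integers, is (generalised) LOG-CONCAVE if
`x i · x (j+1) ≤ x (i+1) · x j` for all `i ≤ j` (`GLC`); for sequences without internal zeros this is the usual
`x (k−1) · x (k+1) ≤ x k ²`, and it extends to every distance `d` (`GLC.dist`).  THEOREM (`glc_convSeq`): the
convolution `c n = Σ_{σ ≤ n} a (n − σ) · b σ` of two such sequences is again such a sequence.  PROOF: the `2 × 2`
minor `c i · c (j+1) − c (i+1) · c j` is the Cauchy–Binet sum `Σ_{σ, σ'} A₁ σ · A₂ σ' · (B₁ σ · B₂ σ' − B₂ σ · B₁ σ')`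
with `A₁ σ = a (i+1−σ)`, `A₂ σ = a (j+1−σ)`, `B₁ σ = b (σ−1)`, `B₂ σ = b σ` (`conv_minor`); symmetrising in
`(σ, σ')` it is half the sum of `G (σ, σ') = (A₁ σ A₂ σ' − A₁ σ' A₂ σ)(B₁ σ B₂ σ' − B₂ σ B₁ σ')`, and for `σ ≤ σ'`
the first factor is `≥ 0` (log-concavity of `a` at distance `j − i`) while the second is `≤ 0` (log-concavity of `b`),
so every `G ≤ 0`.  The level counts of a pairwise disjoint family are convolutions of (truncated) binomial rows
(PuncturedLYMRowsLogConcave), which is where this is used.  Nothing here is about percolation.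
-/

namespace PercRepro.PuncturedLYM.Split.LogConcave

open Finset

/-- A nonnegative sequence on `ℤ`, zero on the negatives, log-concave: `x i · x (j+1) ≤ x (i+1) · x j` for `i ≤ j`. -/
structure GLC (x : ℤ → ℚ) : Prop where
  nonneg : ∀ n, 0 ≤ x n
  neg : ∀ n, n < 0 → x n = 0
  lc : ∀ i j, i ≤ j → x i * x (j + 1) ≤ x (i + 1) * x j

/-- Log-concavity at every distance: `x i · x (j + d) ≤ x (i + d) · x j` for `i ≤ j`, `0 ≤ d`. -/
theorem GLC.dist {x : ℤ → ℚ} (hx : GLC x) (d : ℕ) :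
    ∀ i j : ℤ, i ≤ j → x i * x (j + d) ≤ x (i + d) * x j := by
  induction d with
  | zero => intro i j _; simp
  | succ d ih =>
    intro i j hij
    rcases eq_or_lt_of_le hij with rfl | hlt
    · push_cast; ring_nf; exact le_refl _
    · -- `x i · x (j+d+1) ≤ x (i+1) · x (j+d) ≤ x (i+1+d) · x j`
      have h1 : x i * x (j + d + 1) ≤ x (i + 1) * x (j + d) := hx.lc i (j + d) (by omega)
      have h2 : x (i + 1) * x (j + d) ≤ x (i + 1 + d) * x j := ih (i + 1) j (by omega)
      push_cast
      calc x i * x (j + (d + 1)) = x i * x (j + d + 1) := by ring_nf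
        _ ≤ x (i + 1) * x (j + d) := h1
        _ ≤ x (i + 1 + d) * x j := h2
        _ = x (i + (d + 1)) * x j := by ring_nf

/-- The convolution `c n = Σ_{σ ≤ n} a (n − σ) · b σ` (zero for `n < 0`, as `a` vanishes on the negatives). -/
def convSeq (a b : ℤ → ℚ) (n : ℤ) : ℚ := ∑ σ ∈ range (n.toNat + 1), a (n - σ) * b σ

/-- The convolution over any range `N ≥ n + 1` (the extra terms vanish). -/
theorem conv_eq_range {a b : ℤ → ℚ} (ha : GLC a) (n : ℤ) (N : ℕ) (hN : n + 1 ≤ N) :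
    convSeq a b n = ∑ σ ∈ range N, a (n - σ) * b σ := by
  unfold convSeq
  rcases lt_or_ge n 0 with hn | hn
  · -- every term vanishes
    have hz : ∀ σ : ℕ, a (n - σ) * b σ = 0 := by
      intro σ; rw [ha.neg (n - σ) (by omega), zero_mul]
    rw [sum_eq_zero (fun σ _ => hz σ), sum_eq_zero (fun σ _ => hz σ)]
  · have hsub : range (n.toNat + 1) ⊆ range N := by
      intro σ hσ; rw [mem_range] at hσ ⊢
      have : (n.toNat : ℤ) = n := Int.toNat_of_nonneg hn
      omega
    rw [← sum_subset hsub]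
    intro σ hσ hσ'
    rw [mem_range] at hσ hσ'
    have : (n.toNat : ℤ) = n := Int.toNat_of_nonneg hn
    have : n - σ < 0 := by omega
    rw [ha.neg _ this, zero_mul]

/-- The convolution in shifted form: `c n = Σ_{σ < N} a (n + 1 − σ) · b (σ − 1)` for `N ≥ n + 2`. -/
theorem conv_eq_shift {a b : ℤ → ℚ} (ha : GLC a) (hb : GLC b) (n : ℤ) (N : ℕ) (hN0 : 1 ≤ N) (hN : n + 2 ≤ N) :
    convSeq a b n = ∑ σ ∈ range N, a (n + 1 - σ) * b (σ - 1) := by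
  obtain ⟨N', rfl⟩ : ∃ N', N = N' + 1 := ⟨N - 1, by omega⟩
  rw [sum_range_succ']
  have h0 : a (n + 1 - ((0 : ℕ) : ℤ)) * b (((0 : ℕ) : ℤ) - 1) = 0 := by
    rw [hb.neg ((0 : ℕ) - 1) (by norm_num), mul_zero]
  rw [h0, add_zero, conv_eq_range ha n N' (by omega)]
  apply sum_congr rfl
  intro σ _
  congr 2 <;> push_cast <;> ring

/-- **The Cauchy–Binet identity for the `2 × 2` minor of the convolution.** -/
theorem conv_minor {a b : ℤ → ℚ} (ha : GLC a) (hb : GLC b) (i j : ℤ) (N : ℕ) (hN0 : 1 ≤ N) (hN : j + 3 ≤ N) (hij : i ≤ j) :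
    convSeq a b i * convSeq a b (j + 1) - convSeq a b (i + 1) * convSeq a b j
      = ∑ σ ∈ range N, ∑ σ' ∈ range N,
          a (i + 1 - σ) * a (j + 1 - σ') * (b (σ - 1) * b σ' - b σ * b (σ' - 1)) := by
  have e1 : convSeq a b i = ∑ σ ∈ range N, a (i + 1 - σ) * b (σ - 1) := conv_eq_shift ha hb i N hN0 (by omega)
  have e2 : convSeq a b (i + 1) = ∑ σ ∈ range N, a (i + 1 - σ) * b σ := by
    rw [conv_eq_range ha (i + 1) N (by omega)]
  have e3 : convSeq a b j = ∑ σ ∈ range N, a (j + 1 - σ) * b (σ - 1) := conv_eq_shift ha hb j N hN0 (by omega)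
  have e4 : convSeq a b (j + 1) = ∑ σ ∈ range N, a (j + 1 - σ) * b σ := by
    rw [conv_eq_range ha (j + 1) N (by omega)]
  rw [e1, e2, e3, e4, sum_mul_sum, sum_mul_sum, ← sum_sub_distrib]
  apply sum_congr rfl; intro σ _
  rw [← sum_sub_distrib]
  apply sum_congr rfl; intro σ' _
  ring

/-- Each symmetrised term is nonpositive. -/
theorem G_nonpos {a b : ℤ → ℚ} (ha : GLC a) (hb : GLC b) (i j : ℤ) (hij : i ≤ j) (σ σ' : ℤ) (hσ : σ ≤ σ') :
    (a (i + 1 - σ) * a (j + 1 - σ') - a (i + 1 - σ') * a (j + 1 - σ)) *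
      (b (σ - 1) * b σ' - b σ * b (σ' - 1)) ≤ 0 := by
  obtain ⟨d, hd⟩ : ∃ d : ℕ, j = i + d := ⟨(j - i).toNat, by omega⟩
  -- the `a`-factor is `≥ 0`: log-concavity of `a` at distance `d` at the pair `(i+1−σ', i+1−σ)`
  have hA : 0 ≤ a (i + 1 - σ) * a (j + 1 - σ') - a (i + 1 - σ') * a (j + 1 - σ) := by
    have := ha.dist d (i + 1 - σ') (i + 1 - σ) (by omega)
    have e1 : i + 1 - σ + d = j + 1 - σ := by omega
    have e2 : i + 1 - σ' + d = j + 1 - σ' := by omega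
    rw [e1, e2] at this
    linarith
  -- the `b`-factor is `≤ 0`: log-concavity of `b` at the pair `(σ−1, σ'−1)`
  have hB : b (σ - 1) * b σ' - b σ * b (σ' - 1) ≤ 0 := by
    have := hb.lc (σ - 1) (σ' - 1) (by omega)
    have e1 : σ - 1 + 1 = σ := by ring
    have e2 : σ' - 1 + 1 = σ' := by ring
    rw [e1, e2] at this
    linarith
  exact mul_nonpos_of_nonneg_of_nonpos hA hB

/-- **THEOREM.** The convolution of two log-concave sequences is log-concave. -/
theorem glc_convSeq {a b : ℤ → ℚ} (ha : GLC a) (hb : GLC b) : GLC (convSeq a b) where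
  nonneg := by
    intro n
    unfold convSeq
    exact sum_nonneg (fun σ _ => mul_nonneg (ha.nonneg _) (hb.nonneg _))
  neg := by
    intro n hn
    unfold convSeq
    have : n.toNat = 0 := by omega
    rw [this]
    simp only [zero_add, range_one, sum_singleton, Nat.cast_zero, sub_zero]
    rw [ha.neg n hn, zero_mul]
  lc := by
    intro i j hij
    rcases lt_or_ge j 0 with hj | hj
    · -- `c i = 0` and `c j = 0`
      have hci : convSeq a b i = 0 := by
        unfold convSeq
        apply sum_eq_zero; intro σ _
        rw [ha.neg (i - σ) (by omega), zero_mul]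
      have hcj : convSeq a b j = 0 := by
        unfold convSeq
        apply sum_eq_zero; intro σ _
        rw [ha.neg (j - σ) (by omega), zero_mul]
      rw [hci, hcj, zero_mul, mul_zero]
    set N : ℕ := (j + 3).toNat with hNdef
    have hN : j + 3 ≤ N := by
      have : ((j + 3).toNat : ℤ) = j + 3 := Int.toNat_of_nonneg (by omega)
      omega
    have hN0 : 1 ≤ N := by omega
    have hminor := conv_minor ha hb i j N hN0 hN hij
    -- symmetrise: `2 · S = Σ_{σ σ'} G σ σ' ≤ 0`
    set F : ℤ → ℤ → ℚ := fun σ σ' =>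
      a (i + 1 - σ) * a (j + 1 - σ') * (b (σ - 1) * b σ' - b σ * b (σ' - 1)) with hF
    have hS : ∑ σ ∈ range N, ∑ σ' ∈ range N, F σ σ' = ∑ σ ∈ range N, ∑ σ' ∈ range N, F σ' σ := by
      exact sum_comm
    have hG : ∀ σ σ' : ℤ, F σ σ' + F σ' σ
        = (a (i + 1 - σ) * a (j + 1 - σ') - a (i + 1 - σ') * a (j + 1 - σ)) *
            (b (σ - 1) * b σ' - b σ * b (σ' - 1)) := by
      intro σ σ'; rw [hF]; ring
    have hGle : ∀ σ σ' : ℤ, F σ σ' + F σ' σ ≤ 0 := by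
      intro σ σ'
      rw [hG]
      rcases le_or_gt σ σ' with h | h
      · exact G_nonpos ha hb i j hij σ σ' h
      · have := G_nonpos ha hb i j hij σ' σ h.le
        have e : (a (i + 1 - σ) * a (j + 1 - σ') - a (i + 1 - σ') * a (j + 1 - σ)) *
              (b (σ - 1) * b σ' - b σ * b (σ' - 1))
            = (a (i + 1 - σ') * a (j + 1 - σ) - a (i + 1 - σ) * a (j + 1 - σ')) *
              (b (σ' - 1) * b σ - b σ' * b (σ - 1)) := by ring
        rw [e]; exact this
    have h2S : 2 * ∑ σ ∈ range N, ∑ σ' ∈ range N, F σ σ' ≤ 0 := by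
      have : 2 * ∑ σ ∈ range N, ∑ σ' ∈ range N, F σ σ'
          = ∑ σ ∈ range N, ∑ σ' ∈ range N, (F σ σ' + F σ' σ) := by
        rw [two_mul]
        nth_rewrite 2 [hS]
        rw [← sum_add_distrib]
        apply sum_congr rfl; intro σ _
        rw [← sum_add_distrib]
      rw [this]
      apply sum_nonpos; intro σ _
      apply sum_nonpos; intro σ' _
      exact hGle σ σ'
    have hFm : convSeq a b i * convSeq a b (j + 1) - convSeq a b (i + 1) * convSeq a b j
        = ∑ σ ∈ range N, ∑ σ' ∈ range N, F σ σ' := hminor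
    linarith

end PercRepro.PuncturedLYM.Split.LogConcave
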